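import Literature.AnabelianGeometry.EtaleTheta.Discharge.Sec3Remark363
import Literature.AnabelianGeometry.EtaleTheta.Discharge.Sec3FLambdaInvOfRlf
import Literature.AnabelianGeometry.EtaleTheta.Discharge.Sec3ConstantLineOfRlfZ
import Literature.AnabelianGeometry.EtaleTheta.Discharge.Sec3Prop34CnstOfRlfQ
import HarnessLib

/-!
# [EtTh] Remark 3.6.3 at the three CONSTRUCTED Def. 3.6 (i) data `ofRlfZ`, `ofRlfQ`, `ofRlfR` —
# unconditionally at monoid type `ℝ`

S. Mochizuki, *The étale theta function and its Frobenioid-theoretic manifestations*, Publ. RIMS **45**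
(2009) [MochizukiEtTh2009], §3: Remark 3.6.3, PDF pp. 78–79 (printed 304–305): "the essential image of the
natural functor `C^{bs-fld} → C` consists precisely of … the base-field-theoretic morphisms of `C` between
objects of the essential image. In particular, the natural functor `C^{bs-fld} → C` is isomorphism-full";
Definition 3.6 (i), PDF p. 76: "`B₀^Λ ⊆ (Φ₀^ℝ)^gp` for the monoid `B₀` (respectively, `B₀^pf`;
`ℝ·Φ₀^birat ⊆ (Φ₀^ℝ)^gp`); `F₀^Λ ⊆ B₀^Λ` for the submonoid … `F₀` (respectively, `F₀^pf`; `ℝ·Φ₀^cnst`) if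
`Λ = ℤ` (respectively, `Λ = ℚ`; `Λ = ℝ`)"; Prop. 3.4 (ii), PDF p. 74 (the three isomorphisms
`O_L^× ⥲ Ker(B₀ → Φ₀^gp)`, `O_L^▷ ⥲ B₀ ×_{Φ₀^gp} Φ₀`, `L^× ⥲ F₀`).

PROOF-ONLY companion (abc-iut cell, block F, seat abc-iut-f-136; FACT-LIST row **F-0581**
`TemperedFrobenioid.Remark363`, statement owner abc-iut-L2-t3 `TemperedFrobenioidProps.lean`; the universal
closure over ALL tempered-Frobenioid structures is REFUTED — abc-iut-w5-d135 `ToyFinv.not_remark363`, abc-iut-f-015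
`TemperedFrobenioid.not_forall_remark363` — so the row is consumable only through INSTANCE FORMS).  The tree's
instance form of record is abc-iut-w5-d135's `TemperedFrobenioid.remark363_of_isSharp` /
`remark363_of_prop34Cnst` (`Discharge/Sec3Remark363.lean`): sharp `Φ` + two binders on the Def. 3.6 (i) data,
`hP34Λ` ("a `Λ`-log-meromorphic function with EFFECTIVE log-divisor is constant", GAP row G-w5d124-1) and
`hFinv` ("`F₀^Λ(Y)` is inverse-closed", GAP row G-w5d135-1).  This file evaluates the row at the three
CONSTRUCTED Def. 3.6 (i) data of the tree (`RealifiedDivisorMonoids.ofRlfZ` — abc-iut-L6-t12, `ofRlfQ` —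
abc-iut-w5-d130, `ofRlfR` — abc-iut-w4-d084; all over the canonical monoid vocabulary `treeMonoidVocab`, so
`Φ(A)` is perf-factorial, hence sharp):

* `remark363_of_mem_FΛ_of_cnstR` — a SECOND general instance form: sharp `Φ` + the single binder
  `hcomap : ∀ Y b, Div(b) ∈ ℝ·Φ₀^cnst(Y) → b ∈ F₀^Λ(Y)` ("`F₀^Λ ⊇ B₀^Λ ×_{(Φ₀^ℝ)^gp} ℝ·Φ₀^cnst`"; with the
  typed field `divΛ_mem_cnstR` this says `F₀^Λ = B₀^Λ ×_{(Φ₀^ℝ)^gp} ℝ·Φ₀^cnst`) ⇒ `Remark363`, with NEITHER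
  `hP34Λ` NOR `hFinv`: the `B₀^Λ`-component `b` of the unit of a morphism `hull X → hull Y` with
  base-field-theoretic zero divisor has `Div(b) ∈ ℝ·Φ₀^cnst` OUTRIGHT (abc-iut-w5-d135's
  `divΛ_fst_unit_mem_cnstR`, from the relation of [FrdI] Thm. 5.2 (i) read in `(Φ^{bs-fld})^gp`), so `hcomap`
  alone makes it constant and `exists_hull_map_eq_of_mem_FΛ` lifts the morphism.
* **`remark363_ofRlfR` — Remark 3.6.3 holds UNCONDITIONALLY for every tempered Frobenioid over the
  constructed data of monoid type `ℝ`**: there `B₀^ℝ = ℝ·Φ₀^birat`, `F₀^ℝ = B₀^ℝ ∩ ℝ·Φ₀^cnst` (the preimage of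
  `ℝ·Φ₀^cnst` under `B₀^ℝ ⊆ (Φ₀^ℝ)^gp`, as printed) so `hcomap` is the identity map.  Note that at `ofRlfR`
  the binder `hP34Λ` of the instance form of record is NOT available in general (abc-iut-w4-d084's kernel
  countermodel `Sec3Prop34CnstOfRlfRNegative.not_forall_prop34Cnst_ofRlfR`, GAP row G-w5d130-1) — the
  route here does not pass through it.
* `remark363_ofRlfZ`, `remark363_ofRlfQ` — at monoid types `ℤ`, `ℚ`, Remark 3.6.3 modulo the typed Prop. 3.4
  structure `dm.Prop34` (FACT, [EtTh] Prop. 3.4, node EtTh:Prop3.4(ii)) and the ONE `B₀`-level binder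
  `hF₀inv : ∀ Y b, b ∈ F₀(Y) → ∃ b' ∈ F₀(Y), b'·b = 1` ("`F₀(Y) ≅ L^×` is a group", Prop. 3.4 (ii) third
  isomorphism; not recorded by the Def. 3.3 (iii) interface `DivisorMonoids`, GAP row G-w5d135-1): by name from
  `remark363_of_isSharp` with abc-iut-w4-d008's `RealifiedDivisorMonoids.ofRlfZ_mem_FΛ_of_divΛ_eq_of` /
  abc-iut-w4-d084's `Prop34Cnst.ofRlfQ_mem_FΛ_of_divΛ_eq_of'` (`hP34Λ`) and abc-iut-w5-d135's
  `ofRlfZ_hFinv_iff` / `ofRlfQ_hFinv_of'` (`hFinv`).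

No definition, no instance; nothing of the paper is restated or strengthened; every input is consumed BY NAME.
HONEST FRAMING: refereed pre-IUT material ([EtTh] §3); nothing here bears on the disputed [IUTchIII] Cor. 3.12;
no side taken; typed ≠ proved for the rest of §3.
-/

namespace Literature.AnabelianGeometry.EtaleTheta

open CategoryTheory Opposite Literature.AlgebraicGeometry.Frobenioids

universe u₀ v₀ u v w

namespace TemperedFrobenioid

/-! ## A second general instance form: `F₀^Λ = B₀^Λ ×_{(Φ₀^ℝ)^gp} ℝ·Φ₀^cnst` suffices (no `hP34Λ`, no `hFinv`) -/

section General

variable {D₀ : Type u₀} [Category.{v₀} D₀] {V : FrdIMonoidStub.{w}}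
  {T : RealifiedDivisorMonoids (D₀ := D₀) V} {D : Type u} [Category.{v} D]
  {VD : FrdICatStub.{u, v, w} D} (C : TemperedFrobenioid T D VD)

/-- **The lift, GIVEN `hcomap` only**: if every `b ∈ B₀^Λ(Y)` with `Div(b) ∈ ℝ·Φ₀^cnst(Y)` lies in `F₀^Λ(Y)`,
then every morphism `hull X → hull Y` of `C` with base-field-theoretic zero divisor lies in the image of
`hull` — the `B₀^Λ`-component of its unit has log-divisor in `ℝ·Φ₀^cnst` outright (`divΛ_fst_unit_mem_cnstR`).
[cite: MochizukiEtTh2009, Rmk 3.6.3 p.79] -/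
theorem exists_hull_map_eq_of_mem_FΛ_of_cnstR
    (hcomap : ∀ (Y : D₀ᵒᵖ) (b : T.BΛ.obj Y), T.divΛ Y b ∈ T.cnstR Y → b ∈ T.FΛ Y)
    {X Y : C.hullCategory} (φ : C.hull.obj X ⟶ C.hull.obj Y)
    (hdiv : C.IsBaseFieldTheoreticDiv (ModelFrobenioid.div φ)) :
    ∃ g : X ⟶ Y, C.hull.map g = φ :=
  C.exists_hull_map_eq_of_mem_FΛ φ hdiv (hcomap _ _ (C.divΛ_fst_unit_mem_cnstR φ hdiv))

/-- **Isomorphism-fullness of `C^{bs-fld} → C`** (Rmk 3.6.3, "In particular …") for sharp `Φ`, GIVEN `hcomap`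
only. [cite: MochizukiEtTh2009, Rmk 3.6.3 p.79] -/
theorem isIsomorphismFull_hull_of_mem_FΛ_of_cnstR (hS : ∀ A : D, IsSharp (C.divisorMonoid.obj (op A)))
    (hcomap : ∀ (Y : D₀ᵒᵖ) (b : T.BΛ.obj Y), T.divΛ Y b ∈ T.cnstR Y → b ∈ T.FΛ Y) :
    IsIsomorphismFull C.hull := by
  haveI : C.hull.Faithful := C.hullFaithful_holds
  refine ⟨inferInstance, fun X Y e => ?_⟩
  have hdiv : C.IsBaseFieldTheoreticDiv (ModelFrobenioid.div e.hom) := by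
    rw [C.div_eq_one_of_isIso_of_isSharp hS e.hom]
    exact (C.bsFld.carrier _).one_mem
  have hdiv' : C.IsBaseFieldTheoreticDiv (ModelFrobenioid.div e.inv) := by
    rw [C.div_eq_one_of_isIso_of_isSharp hS e.inv]
    exact (C.bsFld.carrier _).one_mem
  obtain ⟨g, hg⟩ := C.exists_hull_map_eq_of_mem_FΛ_of_cnstR hcomap e.hom hdiv
  obtain ⟨g', hg'⟩ := C.exists_hull_map_eq_of_mem_FΛ_of_cnstR hcomap e.inv hdiv'
  refine ⟨⟨g, g', C.hull.map_injective ?_, C.hull.map_injective ?_⟩, Iso.ext hg⟩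
  · rw [C.hull.map_comp, hg, hg', Iso.hom_inv_id, C.hull.map_id]
  · rw [C.hull.map_comp, hg, hg', Iso.inv_hom_id, C.hull.map_id]

/-- **Remark 3.6.3, morphism clause (⇐)** for sharp `Φ`, GIVEN `hcomap` only: a base-field-theoretic morphism
of `C` between objects of the essential image of `hull` is abstractly equivalent to a morphism in the image of
`hull`. [cite: MochizukiEtTh2009, Rmk 3.6.3 p.79] -/
theorem essImageHom_of_isBaseFieldTheoretic_of_mem_FΛ_of_cnstR
    (hS : ∀ A : D, IsSharp (C.divisorMonoid.obj (op A)))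
    (hcomap : ∀ (Y : D₀ᵒᵖ) (b : T.BΛ.obj Y), T.divΛ Y b ∈ T.cnstR Y → b ∈ T.FΛ Y)
    {A B : C.category} (f : A ⟶ B) (hA : essImageObj C.hull A) (hB : essImageObj C.hull B)
    (hf : C.IsBaseFieldTheoretic f) : essImageHom C.hull f := by
  let eA : C.hull.obj hA.witness ≅ A := hA.getIso
  let eB : C.hull.obj hB.witness ≅ B := hB.getIso
  have hdiv : C.IsBaseFieldTheoreticDiv (ModelFrobenioid.div (eA.hom ≫ f ≫ eB.inv)) :=
    C.isBaseFieldTheoreticDiv_iso_comp_comp_iso hS _ _ _ hf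
  obtain ⟨g, hg⟩ := C.exists_hull_map_eq_of_mem_FΛ_of_cnstR hcomap (eA.hom ≫ f ≫ eB.inv) hdiv
  refine ⟨hA.witness, hB.witness, g, ⟨Arrow.isoMk' _ _ eA eB ?_⟩⟩
  rw [hg]
  simp

/-- **[EtTh] Remark 3.6.3 — second general instance form**: `C.Remark363` for every tempered Frobenioid with
sharp divisor monoids whose Def. 3.6 (i) data satisfy `hcomap : Div(b) ∈ ℝ·Φ₀^cnst ⇒ b ∈ F₀^Λ` (i.e.
`F₀^Λ = B₀^Λ ×_{(Φ₀^ℝ)^gp} ℝ·Φ₀^cnst`); neither `hP34Λ` nor `hFinv` is used.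
[cite: MochizukiEtTh2009, Rmk 3.6.3 p.79] -/
theorem remark363_of_mem_FΛ_of_cnstR (hS : ∀ A : D, IsSharp (C.divisorMonoid.obj (op A)))
    (hcomap : ∀ (Y : D₀ᵒᵖ) (b : T.BΛ.obj Y), T.divΛ Y b ∈ T.cnstR Y → b ∈ T.FΛ Y) :
    C.Remark363 :=
  ⟨C.isIsomorphismFull_hull_of_mem_FΛ_of_cnstR hS hcomap, fun f hA hB =>
    ⟨C.isBaseFieldTheoretic_of_essImageHom hS f,
      C.essImageHom_of_isBaseFieldTheoretic_of_mem_FΛ_of_cnstR hS hcomap f hA hB⟩⟩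

end General

/-! ## The three constructed Def. 3.6 (i) data -/

section Constructed

variable {D₀ : Type u} [Category.{v} D₀] {dm : DivisorMonoids.{u, v, w} D₀}
  {hpf : ∀ Y : D₀ᵒᵖ, IsPerfFactorial (dm.Φ₀.obj Y)} {V : FrdIMonoidStub.{w}} {V₀ : FrdICatStub.{u, v, w} D₀}
  {D : Type u₀} [Category.{v₀} D] {VD : FrdICatStub.{u₀, v₀, w} D}

/-- **[EtTh] Remark 3.6.3 at monoid type `ℝ` — UNCONDITIONAL** for every tempered Frobenioid over the
constructed Def. 3.6 (i) data `RealifiedDivisorMonoids.ofRlfR dm hpf` (`B₀^ℝ = ℝ·Φ₀^birat`,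
`F₀^ℝ = B₀^ℝ ∩ ℝ·Φ₀^cnst`, so `hcomap` is the identity; `Φ(A)` is perf-factorial at the canonical monoid
vocabulary, hence sharp). [cite: MochizukiEtTh2009, Rmk 3.6.3 p.79] -/
theorem remark363_ofRlfR (C : TemperedFrobenioid (RealifiedDivisorMonoids.ofRlfR dm hpf) D VD) :
    C.Remark363 :=
  C.remark363_of_mem_FΛ_of_cnstR (fun A => (C.isPerfFactorial (op A)).isDivisorial.isSharp)
    fun _ _ h => h

/-- **[EtTh] Remark 3.6.3 at monoid type `ℤ`** for every tempered Frobenioid over the constructed Def. 3.6 (i)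
data `RealifiedDivisorMonoids.ofRlfZ dm hpf` (`B₀^ℤ = B₀`, `F₀^ℤ = F₀`), modulo the typed Prop. 3.4 structure
`dm.Prop34` (`hP34Λ` = `ofRlfZ_mem_FΛ_of_divΛ_eq_of`) and the `B₀`-level inverse-closure `hF₀inv` of `F₀`
("`F₀(Y) ≅ L^×`", Prop. 3.4 (ii) third isomorphism; = `hFinv` at `ofRlfZ`, `ofRlfZ_hFinv_iff`).
[cite: MochizukiEtTh2009, Rmk 3.6.3 p.79] -/
theorem remark363_ofRlfZ (C : TemperedFrobenioid (RealifiedDivisorMonoids.ofRlfZ dm hpf) D VD)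
    (h34 : dm.Prop34 V V₀)
    (hF₀inv : ∀ (Y : D₀ᵒᵖ) (b : dm.B₀.obj Y), b ∈ dm.F₀ Y → ∃ b' ∈ dm.F₀ Y, b' * b = 1) :
    C.Remark363 :=
  C.remark363_of_isSharp (fun A => (C.isPerfFactorial (op A)).isDivisorial.isSharp)
    (RealifiedDivisorMonoids.ofRlfZ_mem_FΛ_of_divΛ_eq_of dm hpf h34)
    ((RealifiedDivisorMonoids.ofRlfZ_hFinv_iff dm hpf).2 hF₀inv)

/-- **[EtTh] Remark 3.6.3 at monoid type `ℚ`** for every tempered Frobenioid over the constructed Def. 3.6 (i)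
data `RealifiedDivisorMonoids.ofRlfQ dm hpf` (`B₀^ℚ = B₀^pf`, `F₀^ℚ = F₀^pf`), modulo `dm.Prop34`
(`hP34Λ` = `Prop34Cnst.ofRlfQ_mem_FΛ_of_divΛ_eq_of'`) and `hF₀inv` (`hFinv` = `ofRlfQ_hFinv_of'`: the
perfection of an inverse-closed submonoid is inverse-closed). [cite: MochizukiEtTh2009, Rmk 3.6.3 p.79] -/
theorem remark363_ofRlfQ (C : TemperedFrobenioid (RealifiedDivisorMonoids.ofRlfQ dm hpf) D VD)
    (h34 : dm.Prop34 V V₀)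
    (hF₀inv : ∀ (Y : D₀ᵒᵖ) (b : dm.B₀.obj Y), b ∈ dm.F₀ Y → ∃ b' ∈ dm.F₀ Y, b' * b = 1) :
    C.Remark363 :=
  C.remark363_of_isSharp (fun A => (C.isPerfFactorial (op A)).isDivisorial.isSharp)
    (RealifiedDivisorMonoids.Prop34Cnst.ofRlfQ_mem_FΛ_of_divΛ_eq_of' h34)
    (RealifiedDivisorMonoids.ofRlfQ_hFinv_of' dm hpf hF₀inv)

end Constructed

end TemperedFrobenioid

end Literature.AnabelianGeometry.EtaleTheta
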